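import Mathlib
import Summits.Ventures.FusionMHD.Bench.SAlphaS05W157A06Panels
import Summits.Ventures.FusionMHD.Bench.SAlphaS05W157A53Panels
import Literature.MathematicalPhysics.MHD.BallooningSAlphaWitnessInterval
import HarnessLib

/-!
# F3 — THE UNSTABLE BAND OF THE `s–α` MODEL AT SHEAR `s = 1/2`, CERTIFIED UP TO THE SECOND-STABILITY EDGE: `U_{1/2} ⊇ [3/5, 5/3]` — ONE
# finite-element trial function (window `[-16, 16]`, tuned at `α = 157/100`) is a witness at `α = 3/5` AND at `α = 5/3`, hence — the energy of a
# fixed trial function is a convex quadratic polynomial in `α` (`BallooningSAlphaWitnessInterval.unstableWitness_of_mem_Icc`) — at every `α` between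
(venture LADDER-GRIDFUSION, rung F3; cell `gridfusion`, typed by gridfusion-lit-3 (g14), 2026-08-28.  ONE composition file: 0 `def … : Prop` facts,
0 defs, 0 kit jobs, no `native_decide`, no floating point in any statement; 2 × 16 kernel panel enclosures in the panel files.)

## THREE COLUMNS
CERTIFIED (kernel): in the `s–α` ballooning MODEL (Freidberg (12.96)–(12.99), `Λ = sθ − α sin θ`, `θ₀ = 0`) at shear `s = 1/2`: for EVERY
`α ∈ [3/5, 5/3]` the explicit trial function `X = Spline.trialX (1) 1 SAlphaS05W157.pieces (-16)` (16 quintic pieces, `C²`, dofs in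
`2⁻²⁴ℤ`, `X(±16) = 0`) has NEGATIVE one-surface energy on `[-16, 16]` — `unstableWitness_06` (`W(3/5) ≈ −0.02692`), `unstableWitness_53`
(`W(5/3) ≈ −0.01589`; exact dyadic enclosures in `c06_seg_all` / `c53_seg_all`), then `unstableWitness_band` by convexity in `α`.  So
`U_{1/2} ⊇ [3/5, 5/3]`: the band contains the top `lensHi (1/2) = 3/2` of model-7's two-turn lens (`Models/SAlphaTwoTurnLens`, `U_s ⊇ [lensLo s, lensHi s]`
for `1/2 ≤ s ≤ 3`), its lower end sits above the first-edge bracket of record at `s = 1/2` (★ #221: stable `(1/2, 1/4)`…, conic point `1/2`), and its upper end lies `0.018` below the float second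
edge.  VALIDATED (not in the kernel): shooting edges `α₁(1/2) ≈ 0.390`, `α₂(1/2) ≈ 1.685`; the function's own float chord `(0.58, 1.681)`.  PAIRING (not
imported, not assumed): a certified STABLE point `(1/2, α⁺)` with `α⁺ > 5/3` would make `(5/3, α⁺)` a certified bracket of the SECOND edge at
`s = 1/2`; none is in the tree at the time of writing.  MODELLED: `s–α` model (large-aspect-ratio shifted circles, high-`n` ballooning ordering,
`θ₀ = 0`, ideal MHD); «unstable» = the model's one-surface functional (12.38)/(12.97) is negative on an explicit compactly supported differentiable
trial function vanishing at the ends of its window (lit-3's witness class, Newcomb sense); representation step (Connor–Hastie–Taylor 1979) quoted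
in `BallooningSAlpha.lean`, not typed; no device, no `β`-limit.  Citations: Freidberg 2014 §12.3 (12.38)–(12.40), §12.6.2 (12.97) [Freidberg2014];
Mahboubi–Melquiond–Sibut-Pinote 2016 §3.2–3.3 [MahboubiMelquiondSibutpinote2016].
-/

open Literature.Analysis.ValidatedNumerics Literature.Analysis.ValidatedNumerics.PolyMP
open Literature.Analysis.ValidatedNumerics.NumericsMP Literature.Analysis.ValidatedNumerics.ExpPoly
open Literature.MathematicalPhysics.MHD.Ballooning Literature.MathematicalPhysics.MHD.Ballooning.SAlpha
open Literature.MathematicalPhysics.MHD.Ballooning.SAlpha.Spline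
open Set

namespace Summit.Ventures.FusionMHD.Bench.SAlphaS05W157

/-- THE GLUED SEGMENT at `α = 3/5` in summed form. [cite: MahboubiMelquiondSibutpinote2016, Sect. 3.3] -/
theorem c06_seg_all :
    FSegOK (splineDensity (1/2) (3/5) (-16) 1 1 pieces) [1] (2 ^ 60) (panelLeft 1 0) (panelLeft 1 16) (-31039663800057856) (-31039659039522816) := by
  have h := c06_seg
  norm_num at h
  exact h

/-- THE `[-16, 16]` TRIAL FUNCTION IS A WITNESS AT `(1/2, 3/5)`: `UnstableWitness 1/2 (3/5) (-16) 16 X X′`, `2⁶⁰·W ≤ -31039659039522816` (`W ≈ -0.0269`;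
enclosure `[-0.0269226, -0.0269226]`). [cite: Freidberg2014, §12.3 eqs. (12.38)–(12.40)] -/
theorem unstableWitness_06 :
    UnstableWitness (1/2) (3/5) (-16) 16 (trialX 1 1 pieces (-16)) (trialX' 1 1 pieces (-16)) := by
  have h := unstableWitness_of_spline (s := 1/2) (α := 3/5) (a := -16) (h := 1) (m := 1) (ps := pieces)
    one_pos one_pos pieces_ne_nil pieces_match pieces_deriv_match head_zero last_zero c06_seg_all (by decide)
  rw [pieces_length] at h
  norm_num at h
  exact h

/-- THE GLUED SEGMENT at `α = 5/3` in summed form. [cite: MahboubiMelquiondSibutpinote2016, Sect. 3.3] -/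
theorem c53_seg_all :
    FSegOK (splineDensity (1/2) (5/3) (-16) 1 1 pieces) [1] (2 ^ 60) (panelLeft 1 0) (panelLeft 1 16) (-18324645293850624) (-18324608633536512) := by
  have h := c53_seg
  norm_num at h
  exact h

/-- THE `[-16, 16]` TRIAL FUNCTION IS A WITNESS AT `(1/2, 5/3)`: `UnstableWitness 1/2 (5/3) (-16) 16 X X′`, `2⁶⁰·W ≤ -18324608633536512` (`W ≈ -0.0159`;
enclosure `[-0.0158941, -0.0158941]`). [cite: Freidberg2014, §12.3 eqs. (12.38)–(12.40)] -/
theorem unstableWitness_53 :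
    UnstableWitness (1/2) (5/3) (-16) 16 (trialX 1 1 pieces (-16)) (trialX' 1 1 pieces (-16)) := by
  have h := unstableWitness_of_spline (s := 1/2) (α := 5/3) (a := -16) (h := 1) (m := 1) (ps := pieces)
    one_pos one_pos pieces_ne_nil pieces_match pieces_deriv_match head_zero last_zero c53_seg_all (by decide)
  rw [pieces_length] at h
  norm_num at h
  exact h

/-- ★★ THE BAND: the `[-16, 16]` trial function is a witness at EVERY `α ∈ [3/5, 5/3]` (the energy of a fixed trial function is a convex
quadratic polynomial in `α`): `U_{1/2} ⊇ [3/5, 5/3]`. [cite: Freidberg2014, §12.3 eqs. (12.38)–(12.40)] («… The plasma is unstable», for the band of the MODEL) -/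
theorem unstableWitness_band :
    ∀ α ∈ Icc (3/5 : ℝ) (5/3), UnstableWitness (1/2) α (-16) 16 (trialX 1 1 pieces (-16)) (trialX' 1 1 pieces (-16)) :=
  unstableWitness_of_mem_Icc unstableWitness_06 unstableWitness_53

/-- … hence every point of the band carries SOME witness, [cite: Freidberg2014, §12.3 eqs. (12.38)–(12.40)] -/
theorem exists_unstableWitness_of_mem_band {α : ℝ} (hα : α ∈ Icc (3/5 : ℝ) (5/3)) :
    ∃ a b : ℝ, ∃ X X' : ℝ → ℝ, UnstableWitness (1/2) α a b X X' :=
  ⟨_, _, _, _, unstableWitness_band α hα⟩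

/-- … and none is on the stable side. [cite: Freidberg2014, §12.3 eq. (12.40)] -/
theorem not_stableSide_of_mem_band {α : ℝ} (hα : α ∈ Icc (3/5 : ℝ) (5/3)) : ¬ StableSide (1/2) α := by
  obtain ⟨a, b, X, X', hw⟩ := exists_unstableWitness_of_mem_band hα
  exact fun hs => hs a b X X' hw

end Summit.Ventures.FusionMHD.Bench.SAlphaS05W157
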